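import Summits.QuantumFields.YangMills.Theorems.UnitScaleTiltProp7SPrintDefs
import Summits.QuantumFields.YangMills.Theorems.UnitScaleTiltProp7AxialReprPrint
import Literature.MathematicalPhysics.QuantumFieldTheory.Balaban1983to89.B8Eq131Derivation
import Literature.MathematicalPhysics.QuantumFieldTheory.Balaban1983to89.T3PrintedRegularOrbits
import HarnessLib

/-!
# `UnitScaleTiltProp7ChartSigmaT3` — THE Σ_k BRIDGE AT THE T³ CARRIER: print's (20) in the SURFACE FORM `AvgCondPrint` («∃ (1.29)-restricted u,
# (U₁U₀)^u ∈ Ax_k(𝔅_k, U₀) ∩ 𝔅_k(𝔅_k, V)») FROM ITS EQUATION FORM — with the equation form LOCATED for the route's own (symmetric) averaging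
# (route `UnitScaleTilt`, crux K1 «MinimiserStabilityRegPr» stmt-QuantumFields-19200, stub `stub_existenceMinimalOrbit`, route (α), (S3)(i) `ChartSigmaT3`;
# OWNER ym3-torus-plan g25 2026-08-28 02:15:05Z∕02:15:26Z; def-free, count-neutral)

Cell `ym3-torus` (HUMAN RULING D-0037, YM ladder rung R3 — YM₃ on T³ is a rung, not d = 4, not a mass gap, not Clay).

LOCATED (this seat, bus 2026-08-28): the route's constraint fibre `T3ConstrainedMinimiser.fibre F ℰp` iterates the SYMMETRIC block average of
[Balaban1987RG1] (0.4) (`BlockAveraging.blockAvg ℰp`: staircase loops from the block centre over all orderings), while every [B7]∕[B8] letter of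
print's presentation `S_print` (`Prop7SPrint.IsAxialPrint` = (1.19) `InAx`, `RestrictedPrint` = (1.29) `Restr129`) and print's u-free equation
«Q_k(U₀, ηA) = B» ((1.31)∕(1.37); `B7Eq92Concrete.dbavgCovIter`, `B8Eq131Derivation`) are stated for the COMB average (42)∕(43) of
[Balaban1985Averaging] (`B7Prop2Explicit.avgIter`).  The identity that makes (1.37) equivalent to the surface form — [B7] (88)
`\overline{(U₁U₀)^u}^k = U̿₁ᵏ·Ū₀ᵏ` for the (81)-normalised axial `u` (`B7Eq84Concrete.avgIter_glev`) — is an identity of the COMB k-average and says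
nothing about the symmetric fibre.  WHAT SURVIVES for any covariant averaging is [B7] (11) «Ū^u = (Ū)^u» (`T3PrintedRegularOrbits.descendTo_gaugeAct`)
together with [B7] (87) «u(y) = (\overline{R_{0,y}U₁}^{(k)})⁻¹ on Ω^{(k)}» for a restricted axial `u` (`B8Eq131Derivation.eq87_of_inAx_restr129`): the
values of `u` ON THE COMPARISON LATTICE are the EXPLICIT comb letter `wrec⁻¹` ((85), `B7Eq99Concrete.wrec`), so «(U₁U₀)^u ∈ fibre V» is the u-FREE
equation **(1.37)^cov: `D_{n,K}(U₁U₀)(c) = w(c₋)·V(c)·w(c₊)⁻¹`, `w = \overline{R_{0,·}U₁}^{(k)}` read on the based pullbacks** — the symmetric-fibre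
analogue of print's `U̿₁ᵏ = V·(Ū₀ᵏ)⁻¹`.  This file proves that equivalence and the bridge.

WHAT IS PROVED (sorry-free, no definition; `k := K − n`, `x₀ := Prop7SPrint.basePt F n K`, `U♯ := pull (unitsField (toUField U)) x₀`,
`u♯ := pullGauge (toUnits ∘ toUGauge u) x₀`, `L := (F.P K).L`; the ℤᵈ coordinates `z y` of a comparison-lattice site `y` enter through the
geometric identity `hz : embIter k (siteShift y) = transl x₀ (Lᵏ • z y)`, discharged for the canonical coordinates by
`Prop7AxialReprPrint.embIter_eq_transl` in the `_canonical` corollaries):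
* §1 **`toUnits_descTransf_eq_wrec_inv`** — for a RESTRICTED `u` (`RestrictedPrint`) with `(U₁U₀)^u` AXIAL (`IsAxialPrint`), the descended gauge
  transformation `u↓ = descTransf u` on the comparison lattice is `(wrec L U₀♯ U₁♯ k (z y))⁻¹` — [B7] (87) at the T³ objects ([B8] (1.29) has only its
  top level on the torus, `torusLam`).
* §2 **`gaugeAct_mem_fibre_iff_eq137cov`** — for such `u`: `(U₁U₀)^u ∈ fibre F ℰp n K h V ↔ (1.37)^cov` (bondwise, in `(M₂(ℂ))ˣ`):
  `D_{n,K}(U₁U₀)(c) = w(z c₋)·V(c)·w(z c₊)⁻¹`.  Both directions: the equation form IS the fibre clause of Σ_k.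
* §3 **`avgCondPrint_of_restrictedAxial_of_eq137cov`** — `Prop7SPrint.AvgCondPrint F n K h V U₀ X` ⇐ (σ1) for every `U₁` with `U₁ = e^{iX}`
  bondwise there is a restricted `u` with `(U₁U₀)^u` axial (the (1.29)-NORMALISED AXIAL GAUGE FIXING at the T³ objects — DISPLAYED: on `ℤᵈ` it is
  `B7Eq84Concrete.gaugeFixing_exists` (pure algebra, `glev`); its descent to the torus needs `glev` of the based pullbacks PERIODIC and `SU(2)`-VALUED,
  not in the tree) ∧ (1.37)^cov; `…_canonical` with the canonical coordinates; and the converse `eq137cov_of_avgCond_witness`.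
HONEST FRAMING.  Bookkeeping by name over landed letters; no estimate; nothing of [Balaban1985Variational]∕[Balaban1985RegularSpaces]∕[Balaban1985Averaging]
is asserted; (σ1) at T³ and the derivation of (1.37)^cov from the (115)-solution (CHART-5-T³, whose averaging is the SYMMETRIC one — not
`B11Prop3Concrete`'s comb `Cmap`) stay displayed; `--supports stmt-QuantumFields-19200 --as helper`.

References: T. Bałaban, CMP 98 (1985) 17–51 [Balaban1985Averaging] ((11) p.19, (42)–(43) pp.23–24, (78)–(88) pp.30–31); CMP 99 (1985) 75–102
[Balaban1985RegularSpaces] ((1.19) p.79, (1.28)–(1.31) pp.81–82, (1.37) p.82); CMP 102 (1985) 277–309 [Balaban1985Variational] ((20) p.281, p.299);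
CMP 109 (1987) 249–301 [Balaban1987RG1] ((0.4)–(0.7) p.253).
-/

set_option autoImplicit false

noncomputable section

namespace Summit.QuantumFields.YangMills.Theorems.Prop7ChartSigmaT3

open scoped Matrix.Norms.L2Operator
open NormedSpace
open Literature.MathematicalPhysics.QuantumFieldTheory.Balaban1983to89
open Literature.MathematicalPhysics.QuantumFieldTheory.Balaban1983to89.T3ContinuumYM3Torus
open Literature.MathematicalPhysics.QuantumFieldTheory.Balaban1983to89.T3LevelShift (siteShift)
open Literature.MathematicalPhysics.QuantumFieldTheory.Balaban1983to89.T3UnitLawDensityEML (ℰp)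
open Literature.MathematicalPhysics.QuantumFieldTheory.Balaban1983to89.T3TiltDescent (descendTo)
open Literature.MathematicalPhysics.QuantumFieldTheory.Balaban1983to89.T3ConstrainedMinimiser (fibre)
open Literature.MathematicalPhysics.QuantumFieldTheory.Balaban1983to89.T3PrintedRegularOrbits (descTransf descendTo_gaugeAct sites_eq)
open B7Prop1Explicit renaming Site → LSite
open B7Eq92Concrete (mgauge mgauge_mul)
open B7Eq99Concrete (wrec)
open B7AvgGaugeCovariance (uLev)
open B8Eq119TwistedAxial (InAx Restr129)
open B8Eq131Derivation (eq87_of_inAx_restr129)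
open B8Thm4TorusAt (torusLam mem_torusLam_iff)
open B15DeterminingSets (embIter)
open B10Eq27TorusAxialLog (pull pull_apply transl unitsField toUField val_unitsField)
open B8Thm2SetupTorus (pullGauge pullGauge_apply toUGauge)
open T3SectALandauChart (emb15)
open Summit.QuantumFields.YangMills.Theorems.Prop7SPrint (basePt IsAxialPrint RestrictedPrint AvgCondPrint)
open Summit.QuantumFields.YangMills.Theorems.Prop7AxialReprPrint (embIter_eq_transl pull_toUField_gaugeAct)
open Summit.QuantumFields.YangMills.Theorems.Prop7FlatHolonomy (transfUp_eq_embIter)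

variable (F : T3Family) {n K : ℕ} (h : n ≤ K)

/-! ## §1 [B7] (87) at the T³ objects: a restricted axial `u` is `wrec⁻¹` on the comparison lattice -/

/-- The based pullback of `U₁U₀` is the product of the based pullbacks (local helper, the `hmul` of `Prop7AxialReprPrint.eq_of_inAx_restr129_based`).
[cite: Balaban1985Variational, (15) p.280] -/
theorem pull_emb15 (U₀ U₁ : GaugeField (F.P K) 0 (Matrix.specialUnitaryGroup (Fin 2) ℂ)) (x₀ : Site (F.P K) 0) :
    pull (unitsField (toUField (emb15 U₀ U₁))) x₀ = pull (unitsField (toUField U₁)) x₀ * pull (unitsField (toUField U₀)) x₀ := by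
  funext z μ
  simp only [pull_apply, Pi.mul_apply]
  apply Units.ext
  rw [val_unitsField, Units.val_mul, val_unitsField, val_unitsField]
  rfl

/-- **[B7] (87) AT THE T³ OBJECTS**: if `u` is (1.29)-restricted relative to `U₀` (`RestrictedPrint`) and `(U₁U₀)^u` lies in the axial gauge (1.19) relative to
`U₀` (`IsAxialPrint`), then on the comparison lattice `u↓(y) = (\overline{R_{0,y}U₁}^{(k)})⁻¹` — the descended gauge transformation IS the explicit comb
letter `wrec⁻¹` of [Balaban1985Averaging] (85), read on the pullbacks based at `x₀` (`z` = ℤᵈ coordinates of `y`, through `hz`).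
[cite: Balaban1985Averaging, (84)–(87) pp.30–31; Balaban1985RegularSpaces, (1.19) p.79, (1.29) p.81] -/
theorem toUnits_descTransf_eq_wrec_inv (u : GaugeTransf (F.P K) 0 (Matrix.specialUnitaryGroup (Fin 2) ℂ))
    (U₀ U₁ : GaugeField (F.P K) 0 (Matrix.specialUnitaryGroup (Fin 2) ℂ))
    (hR : RestrictedPrint F n K U₀ u) (hA : IsAxialPrint F n K U₀ (GaugeField.gaugeAct u (emb15 U₀ U₁)))
    (y : Site (F.P n) 0) (z : LSite (F.P K).d)
    (hz : embIter (K - n) (siteShift (sites_eq F n K h) y) = transl (basePt F n K) ((((F.P K).L : ℤ) ^ (K - n)) • z)) :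
    Unitary.toUnits (toUGauge (F.P n) 2 (descTransf F n K h u) y)
      = (wrec (F.P K).L (pull (unitsField (toUField U₀)) (basePt F n K)) (pull (unitsField (toUField U₁)) (basePt F n K)) (K - n) z)⁻¹ := by
  have hL : 1 ≤ (F.P K).L := (F.P K).hL.2.le
  -- (1.19) for the based pullback of `(U₁U₀)^u`, in the `mgauge` form `eq87_of_inAx_restr129` reads
  have hAx : InAx (F.P K).L (K - n) (torusLam (K - n)) (pull (unitsField (toUField U₀)) (basePt F n K))
      (mgauge (pull (unitsField (toUField U₀)) (basePt F n K))
          (pullGauge (fun x => Unitary.toUnits (toUGauge (F.P K) 2 u x)) (basePt F n K))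
          (pull (unitsField (toUField U₁)) (basePt F n K)) * pull (unitsField (toUField U₀)) (basePt F n K)) := by
    have hA' : InAx (F.P K).L (K - n) (torusLam (K - n)) (pull (unitsField (toUField U₀)) (basePt F n K))
        (pull (unitsField (toUField (GaugeField.gaugeAct u (emb15 U₀ U₁)))) (basePt F n K)) := hA
    rw [pull_toUField_gaugeAct, pull_emb15, ← mgauge_mul] at hA'
    exact hA'
  have h87 := eq87_of_inAx_restr129 (F.P K).L hL (K - n) (torusLam (K - n)) _ _ _ hAx hR (K - n) le_rfl z
    ((mem_torusLam_iff (K - n) (K - n) z).2 rfl)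
  -- `uLev L u♯ k z = u♯ (Lᵏ • z) = u (transl x₀ (Lᵏ • z)) = u (embIter k (siteShift y)) = u↓ y`
  rw [← h87]
  show _ = pullGauge (fun x => Unitary.toUnits (toUGauge (F.P K) 2 u x)) (basePt F n K) ((((F.P K).L : ℤ) ^ (K - n)) • z)
  rw [pullGauge_apply, ← hz]
  simp only [descTransf, B8Thm2SetupTorus.toUGauge_apply, transfUp_eq_embIter]
  rfl

/-! ## §2 The fibre clause of Σ_k IS the u-free equation (1.37)^cov -/

/-- The gauge action read in the units of `M₂(ℂ)`: `unitsField (toUField (D^w)) = (unitsField (toUField D))^{toUnits ∘ toUGauge w}` (bondwise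
`w(c₋)·D(c)·w(c₊)⁻¹`; `suIncl` and `toUnits` are multiplicative). [cite: Balaban1985Averaging, (8) p.19, (19) p.21] -/
theorem unitsField_toUField_gaugeAct {P : Params} (w : GaugeTransf P 0 (Matrix.specialUnitaryGroup (Fin 2) ℂ))
    (D : GaugeField P 0 (Matrix.specialUnitaryGroup (Fin 2) ℂ)) (c : PBond P 0) :
    unitsField (toUField (GaugeField.gaugeAct w D)) c
      = Unitary.toUnits (toUGauge P 2 w c.src) * unitsField (toUField D) c * (Unitary.toUnits (toUGauge P 2 w c.tgt))⁻¹ := by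
  have h1 : toUField (GaugeField.gaugeAct w D) = B10Eq27TorusAxialLog.gaugeActT (toUGauge P 2 w) (toUField D) := by
    funext b
    rw [← B10Eq27TorusAxialLog.gaugeActT_eq_gaugeAct]
    simp only [toUField, B10Eq27TorusAxialLog.gaugeActT_apply, B8Thm2SetupTorus.toUGauge_apply, map_mul, map_inv]
  rw [h1, Summit.QuantumFields.YangMills.Theorems.Prop7ChartInjectivityPrint.unitsField_gaugeActT, B10Eq27TorusAxialLog.gaugeActT_apply]

/-- `unitsField ∘ toUField` is injective bondwise (same matrices). [cite: Balaban1985Averaging, (19) p.21] -/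
theorem eq_of_unitsField_toUField_eq {P : Params} {A B : GaugeField P 0 (Matrix.specialUnitaryGroup (Fin 2) ℂ)} {c : PBond P 0}
    (hc : unitsField (toUField A) c = unitsField (toUField B) c) : A c = B c := by
  have h' := congrArg (fun g : (Matrix (Fin 2) (Fin 2) ℂ)ˣ => (g : Matrix (Fin 2) (Fin 2) ℂ)) hc
  simp only [val_unitsField] at h'
  exact Subtype.ext h'

/-- **THE FIBRE CLAUSE OF Σ_k IS THE EQUATION (1.37)^cov** ([B8] p.81 «(Ũ₁^{u j})_b = … = V_b(Ū₀ʲ)_b⁻¹» in the form valid for the route's SYMMETRIC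
averaging): for a (1.29)-restricted `u` with `(U₁U₀)^u` axial, `(U₁U₀)^u ∈ 𝔅_k(𝔅_k, V)` (the descent fibre `fibre F ℰp n K h V`) iff, bond by bond on
the comparison lattice, `D_{n,K}(U₁U₀)(c) = w(c₋)·V(c)·w(c₊)⁻¹` with the EXPLICIT comb letter `w = \overline{R_{0,·}U₁}^{(k)}` ((85), `wrec` on the based
pullbacks) — covariance [B7] (11) of the descent plus §1.  `z` = ℤᵈ coordinates of the comparison sites (through `hz`).
[cite: Balaban1985Averaging, (11) p.19, (85)–(88) p.31; Balaban1985RegularSpaces, (1.28)–(1.31) pp.81–82] -/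
theorem gaugeAct_mem_fibre_iff_eq137cov (u : GaugeTransf (F.P K) 0 (Matrix.specialUnitaryGroup (Fin 2) ℂ))
    (U₀ U₁ : GaugeField (F.P K) 0 (Matrix.specialUnitaryGroup (Fin 2) ℂ))
    (hR : RestrictedPrint F n K U₀ u) (hA : IsAxialPrint F n K U₀ (GaugeField.gaugeAct u (emb15 U₀ U₁)))
    (V : GaugeField (F.P n) 0 (Matrix.specialUnitaryGroup (Fin 2) ℂ)) (z : Site (F.P n) 0 → LSite (F.P K).d)
    (hz : ∀ y, embIter (K - n) (siteShift (sites_eq F n K h) y) = transl (basePt F n K) ((((F.P K).L : ℤ) ^ (K - n)) • z y)) :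
    GaugeField.gaugeAct u (emb15 U₀ U₁) ∈ fibre F ℰp n K h V ↔
      ∀ c : PBond (F.P n) 0,
        unitsField (toUField (descendTo F ℰp n K h (emb15 U₀ U₁))) c
          = wrec (F.P K).L (pull (unitsField (toUField U₀)) (basePt F n K)) (pull (unitsField (toUField U₁)) (basePt F n K)) (K - n) (z c.src)
            * unitsField (toUField V) c
            * (wrec (F.P K).L (pull (unitsField (toUField U₀)) (basePt F n K)) (pull (unitsField (toUField U₁)) (basePt F n K)) (K - n) (z c.tgt))⁻¹ := by
  have hdu : ∀ y, Unitary.toUnits (toUGauge (F.P n) 2 (descTransf F n K h u) y)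
      = (wrec (F.P K).L (pull (unitsField (toUField U₀)) (basePt F n K)) (pull (unitsField (toUField U₁)) (basePt F n K)) (K - n) (z y))⁻¹ :=
    fun y => toUnits_descTransf_eq_wrec_inv F h u U₀ U₁ hR hA y (z y) (hz y)
  show descendTo F ℰp n K h (GaugeField.gaugeAct u (emb15 U₀ U₁)) = V ↔ _
  rw [descendTo_gaugeAct]
  constructor
  · intro hV c
    have hc : unitsField (toUField (GaugeField.gaugeAct (descTransf F n K h u) (descendTo F ℰp n K h (emb15 U₀ U₁)))) c
        = unitsField (toUField V) c := by rw [hV]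
    rw [unitsField_toUField_gaugeAct, hdu, hdu, inv_inv] at hc
    rw [← hc]
    group
  · intro h137
    funext c
    apply eq_of_unitsField_toUField_eq
    rw [unitsField_toUField_gaugeAct, hdu, hdu, inv_inv, h137 c]
    group

/-- … the same with the CANONICAL ℤᵈ coordinates `z y := (siteShift y)·val` of the comparison sites (`Prop7AxialReprPrint.embIter_eq_transl`).
[cite: Balaban1985Averaging, (11) p.19, (85)–(88) p.31; Balaban1985RegularSpaces, (1.28)–(1.31) pp.81–82] -/
theorem gaugeAct_mem_fibre_iff_eq137cov_canonical (u : GaugeTransf (F.P K) 0 (Matrix.specialUnitaryGroup (Fin 2) ℂ))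
    (U₀ U₁ : GaugeField (F.P K) 0 (Matrix.specialUnitaryGroup (Fin 2) ℂ))
    (hR : RestrictedPrint F n K U₀ u) (hA : IsAxialPrint F n K U₀ (GaugeField.gaugeAct u (emb15 U₀ U₁)))
    (V : GaugeField (F.P n) 0 (Matrix.specialUnitaryGroup (Fin 2) ℂ)) :
    GaugeField.gaugeAct u (emb15 U₀ U₁) ∈ fibre F ℰp n K h V ↔
      ∀ c : PBond (F.P n) 0,
        unitsField (toUField (descendTo F ℰp n K h (emb15 U₀ U₁))) c
          = wrec (F.P K).L (pull (unitsField (toUField U₀)) (basePt F n K)) (pull (unitsField (toUField U₁)) (basePt F n K)) (K - n)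
              (fun μ => (((siteShift (sites_eq F n K h) c.src) μ).val : ℤ))
            * unitsField (toUField V) c
            * (wrec (F.P K).L (pull (unitsField (toUField U₀)) (basePt F n K)) (pull (unitsField (toUField U₁)) (basePt F n K)) (K - n)
              (fun μ => (((siteShift (sites_eq F n K h) c.tgt) μ).val : ℤ)))⁻¹ :=
  gaugeAct_mem_fibre_iff_eq137cov F h u U₀ U₁ hR hA V (fun y μ => (((siteShift (sites_eq F n K h) y) μ).val : ℤ))
    fun y => embIter_eq_transl (by show K - n ≤ F.m + K; omega) _

/-! ## §3 The Σ_k bridge: `AvgCondPrint` from the restricted axial gauge fixing and (1.37)^cov -/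

/-- **THE Σ_k BRIDGE** ([B11] p.299 «we apply to it a gauge transformation u satisfying R̄₀u = 1 on Λ_j and such that (U₁U₀)^u satisfies the axial gauge
conditions»; [B8] (1.28)–(1.31)): print's (20) in its SURFACE form `AvgCondPrint F n K h V U₀ X` («∃ (1.29)-restricted u, (e^{iX}U₀)^u ∈ Ax_k(𝔅_k, U₀) ∩
𝔅_k(𝔅_k, V)») follows from (σ1) the (1.29)-NORMALISED AXIAL GAUGE FIXING at the T³ objects (for every `U₁ = e^{iX}` a restricted `u` with `(U₁U₀)^u`
axial — displayed; on `ℤᵈ` it is `B7Eq84Concrete.gaugeFixing_exists`) and the EQUATION (1.37)^cov for `D_{n,K}(U₁U₀)`.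
[cite: Balaban1985Variational, (20) p.281, p.299; Balaban1985RegularSpaces, (1.28)–(1.31) pp.81–82; Balaban1985Averaging, (77)–(88) pp.30–31] -/
theorem avgCondPrint_of_restrictedAxial_of_eq137cov (V : GaugeField (F.P n) 0 (Matrix.specialUnitaryGroup (Fin 2) ℂ))
    (U₀ : GaugeField (F.P K) 0 (Matrix.specialUnitaryGroup (Fin 2) ℂ)) (X : PBond (F.P K) 0 → Matrix (Fin 2) (Fin 2) ℂ)
    (z : Site (F.P n) 0 → LSite (F.P K).d)
    (hz : ∀ y, embIter (K - n) (siteShift (sites_eq F n K h) y) = transl (basePt F n K) ((((F.P K).L : ℤ) ^ (K - n)) • z y))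
    (hσ : ∀ U₁ : GaugeField (F.P K) 0 (Matrix.specialUnitaryGroup (Fin 2) ℂ),
      (∀ b : PBond (F.P K) 0, ((U₁ b : Matrix.specialUnitaryGroup (Fin 2) ℂ) : Matrix (Fin 2) (Fin 2) ℂ) = exp (Complex.I • X b)) →
        ∃ u : GaugeTransf (F.P K) 0 (Matrix.specialUnitaryGroup (Fin 2) ℂ),
          RestrictedPrint F n K U₀ u ∧ IsAxialPrint F n K U₀ (GaugeField.gaugeAct u (emb15 U₀ U₁)))
    (h137 : ∀ U₁ : GaugeField (F.P K) 0 (Matrix.specialUnitaryGroup (Fin 2) ℂ),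
      (∀ b : PBond (F.P K) 0, ((U₁ b : Matrix.specialUnitaryGroup (Fin 2) ℂ) : Matrix (Fin 2) (Fin 2) ℂ) = exp (Complex.I • X b)) →
        ∀ c : PBond (F.P n) 0,
          unitsField (toUField (descendTo F ℰp n K h (emb15 U₀ U₁))) c
            = wrec (F.P K).L (pull (unitsField (toUField U₀)) (basePt F n K)) (pull (unitsField (toUField U₁)) (basePt F n K)) (K - n) (z c.src)
              * unitsField (toUField V) c
              * (wrec (F.P K).L (pull (unitsField (toUField U₀)) (basePt F n K)) (pull (unitsField (toUField U₁)) (basePt F n K)) (K - n) (z c.tgt))⁻¹) :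
    AvgCondPrint F n K h V U₀ X := by
  intro U₁ hU₁
  obtain ⟨u, hR, hA⟩ := hσ U₁ hU₁
  exact ⟨u, hR, hA, (gaugeAct_mem_fibre_iff_eq137cov F h u U₀ U₁ hR hA V z hz).2 (h137 U₁ hU₁)⟩

/-- **THE Σ_k BRIDGE, CANONICAL COORDINATES** (`z y := (siteShift y)·val`, `hz` by `embIter_eq_transl`).
[cite: Balaban1985Variational, (20) p.281, p.299; Balaban1985RegularSpaces, (1.28)–(1.31) pp.81–82] -/
theorem avgCondPrint_of_restrictedAxial_of_eq137cov_canonical (V : GaugeField (F.P n) 0 (Matrix.specialUnitaryGroup (Fin 2) ℂ))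
    (U₀ : GaugeField (F.P K) 0 (Matrix.specialUnitaryGroup (Fin 2) ℂ)) (X : PBond (F.P K) 0 → Matrix (Fin 2) (Fin 2) ℂ)
    (hσ : ∀ U₁ : GaugeField (F.P K) 0 (Matrix.specialUnitaryGroup (Fin 2) ℂ),
      (∀ b : PBond (F.P K) 0, ((U₁ b : Matrix.specialUnitaryGroup (Fin 2) ℂ) : Matrix (Fin 2) (Fin 2) ℂ) = exp (Complex.I • X b)) →
        ∃ u : GaugeTransf (F.P K) 0 (Matrix.specialUnitaryGroup (Fin 2) ℂ),
          RestrictedPrint F n K U₀ u ∧ IsAxialPrint F n K U₀ (GaugeField.gaugeAct u (emb15 U₀ U₁)))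
    (h137 : ∀ U₁ : GaugeField (F.P K) 0 (Matrix.specialUnitaryGroup (Fin 2) ℂ),
      (∀ b : PBond (F.P K) 0, ((U₁ b : Matrix.specialUnitaryGroup (Fin 2) ℂ) : Matrix (Fin 2) (Fin 2) ℂ) = exp (Complex.I • X b)) →
        ∀ c : PBond (F.P n) 0,
          unitsField (toUField (descendTo F ℰp n K h (emb15 U₀ U₁))) c
            = wrec (F.P K).L (pull (unitsField (toUField U₀)) (basePt F n K)) (pull (unitsField (toUField U₁)) (basePt F n K)) (K - n)
                (fun μ => (((siteShift (sites_eq F n K h) c.src) μ).val : ℤ))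
              * unitsField (toUField V) c
              * (wrec (F.P K).L (pull (unitsField (toUField U₀)) (basePt F n K)) (pull (unitsField (toUField U₁)) (basePt F n K)) (K - n)
                (fun μ => (((siteShift (sites_eq F n K h) c.tgt) μ).val : ℤ)))⁻¹) :
    AvgCondPrint F n K h V U₀ X :=
  avgCondPrint_of_restrictedAxial_of_eq137cov F h V U₀ X (fun y μ => (((siteShift (sites_eq F n K h) y) μ).val : ℤ))
    (fun y => embIter_eq_transl (by show K - n ≤ F.m + K; omega) _) hσ h137

/-- **CONVERSELY, EVERY Σ_k WITNESS SATISFIES (1.37)^cov**: if `u` is restricted, `(U₁U₀)^u` axial and in the fibre of `V`, then `D_{n,K}(U₁U₀)` solves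
(1.37)^cov — the equation form is EQUIVALENT to the fibre clause along the surface (print p.83 «the condition (1.37) is basically of an algebraic
character and it follows from the construction»), here for the symmetric averaging. [cite: Balaban1985RegularSpaces, p.83, (1.30)–(1.31) pp.81–82] -/
theorem eq137cov_of_avgCond_witness (u : GaugeTransf (F.P K) 0 (Matrix.specialUnitaryGroup (Fin 2) ℂ))
    (U₀ U₁ : GaugeField (F.P K) 0 (Matrix.specialUnitaryGroup (Fin 2) ℂ)) (V : GaugeField (F.P n) 0 (Matrix.specialUnitaryGroup (Fin 2) ℂ))
    (hR : RestrictedPrint F n K U₀ u) (hA : IsAxialPrint F n K U₀ (GaugeField.gaugeAct u (emb15 U₀ U₁)))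
    (hV : GaugeField.gaugeAct u (emb15 U₀ U₁) ∈ fibre F ℰp n K h V) (c : PBond (F.P n) 0) :
    unitsField (toUField (descendTo F ℰp n K h (emb15 U₀ U₁))) c
      = wrec (F.P K).L (pull (unitsField (toUField U₀)) (basePt F n K)) (pull (unitsField (toUField U₁)) (basePt F n K)) (K - n)
          (fun μ => (((siteShift (sites_eq F n K h) c.src) μ).val : ℤ))
        * unitsField (toUField V) c
        * (wrec (F.P K).L (pull (unitsField (toUField U₀)) (basePt F n K)) (pull (unitsField (toUField U₁)) (basePt F n K)) (K - n)
          (fun μ => (((siteShift (sites_eq F n K h) c.tgt) μ).val : ℤ)))⁻¹ :=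
  (gaugeAct_mem_fibre_iff_eq137cov_canonical F h u U₀ U₁ hR hA V).1 hV c

end Summit.QuantumFields.YangMills.Theorems.Prop7ChartSigmaT3

end
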